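import Literature.NumberTheory.Transcendental.UnivExtChartLattice
import Literature.NumberTheory.Transcendental.PolyODEJets
import Literature.NumberTheory.Transcendental.PkappaTheta
import HarnessLib

/-!
# Chart generators of `M_κ` along a complex line and their polynomial differential system

Topic: `Literature/NumberTheory/Transcendental`. Plan item W4 ("LineODE", part 1) of the unit
`provefact-Literature.NumberTheory.Transcendental.H-b596640137` (fact
`Literature.NumberTheory.Transcendental.HuberWustholzOnePeriods`). Baker's method on the groups
`M_κ = 𝔾ₘ^β × P_κ` (`SemistableQuotients.lean`, theta model `PkappaTheta.lean`) reads the jets of a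
form `P(Θ)` along a line `ξ ↦ w + ξx` in `Lie M_κ,ℂ` through an affine chart
(`LineJetsBasic.lean`), in which every coordinate is a polynomial in finitely many **generators**
whose derivatives along the line are again polynomials in them — so that the jets are the values of
explicit polynomials (`PolyODEJets.lean`). This file fixes the generators and PROVES their
differential system:

* index type `GaGmE.Std.Gen β γ δ = β ⊕ ((γ × Fin 2) ⊕ δ)`; a **chart choice** `c : γ → Bool`
  (`true` = the chart at the origin of the `b`-th factor `E`, `false` = the generic chart);
* `GaGmE.Std.genFun L κ c w x ξ : Gen → ℂ` — along the line: `E_j = e^{y'_j}` (torus), for each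
  `b` either `(℘, ℘′)` (generic) or `(u, p)` of `UnivExtChartLattice.lean` (origin chart) at
  `z'_b = w_b + ξx_b`, and the **regularised fibre coordinates**
  `Ñ_e = s'_e - ∑_b κ_{eb} ζ̂_b(z'_b)`, `ζ̂ = ζ` (generic) resp. `g` (origin chart) — these, unlike
  `s'_e` and `ζ(z'_b)` separately, are affine coordinates of `M_κ` (`Ñ_e = Θ_{(none,(M₀,e))}/Θ_{J₀}`,
  sequel) and hence take algebraic values at algebraic points;
* `GaGmE.Std.genODE L κ c x : Gen → ℂ[Gen]` — the right-hand sides: `E_j′ = x_jE_j`,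
  `℘′ = x_b·℘′`, `(℘′)′ = x_b(6℘² - g₂/2)`, resp. `u′ = x_b(-6p² + (g₂/2)u²)`,
  `p′ = x_b(-1/2 - g₂pu - (3g₃/2)u²)`, and `Ñ_e′ = x_e + ∑_b κ_{eb}x_b℘_b` (generic `b`)
  `… - ∑_b κ_{eb}x_b(-2g₂p_b² - 3g₃p_bu_b)` (origin-chart `b`) — polynomials with coefficients in
  `ℚ(g₂, g₃, κ)[x]` (the invariant derivations of `M_κ` act on its affine coordinate rings,
  Baker–Wüstholz §6.7);
* `GaGmE.Std.chartDomain` — the open set of parameters `ξ` where the chosen charts are valid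
  (`z'_b ∉ Λ`, resp. `P₂(z'_b) ≠ 0`), and `GaGmE.Std.hasDerivAt_genFun` — **on it the generators
  solve the system** `(genFun ξ i)′ = (genODE i)(genFun ξ)`, the hypothesis of
  `PolyODE.iteratedDeriv_eval_of_ode`;
* `GaGmE.Std.chartChoiceAt` — at every `w` there is a valid chart choice (origin chart exactly at
  the factors with `w_b ∈ Λ`), `zero_mem_chartDomain_chartChoiceAt`.

The expression of the chart coordinates `Θ_J/Θ_{J₀}` as polynomials in the generators and the
resulting jet formula follow in the sequel.

## References

* A. Baker, G. Wüstholz, *Logarithmic Forms and Diophantine Geometry*, CUP 2007, §6.7 (the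
  operators act on `R`), §6.8 (p. 118: `Φ(w) = exp_G(wv)`, `Ψ = Φ^*(LP)`).
* A. Baker, *Transcendental Number Theory*, CUP 1975, Ch. 2 §3 (derivatives of the auxiliary
  function are polynomials in the same functions).
-/

noncomputable section

open Complex Filter Topology MvPolynomial
open scoped PeriodPair

namespace Literature.NumberTheory.Transcendental

namespace GaGmE

namespace Std

variable {β γ δ : Type} [Fintype β] [Fintype γ] [Fintype δ] [DecidableEq γ]
variable (L : PeriodPair) (κM : δ → γ → Kbar)

/-! ### Generators and their differential system -/

/-- Index type of the chart generators of `M_κ` along a line: one for each torus coordinate,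
two for each `E`-factor, one for each fibre coordinate. [folklore] -/
abbrev Gen (β γ δ : Type) : Type := β ⊕ ((γ × Fin 2) ⊕ δ)

/-- The two generators of the `b`-th `E`-factor at the point `z`: `(℘, ℘′)(z)` in the generic
chart (`lat = false`), `(u, p)(z)` in the chart at the origin (`lat = true`). [folklore] -/
def factorGen (lat : Bool) (i : Fin 2) (z : ℂ) : ℂ :=
  if lat then ![L.latU z, L.latP z] i else ![℘[L] z, ℘'[L] z] i

/-- The `ζ`-type function of a factor chart entering the fibre coordinates: `ζ` (generic),
`g = Z₂/P₂` (origin chart). [folklore] -/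
def zetaHat (lat : Bool) (z : ℂ) : ℂ := if lat then L.latG z else L.weierstrassZeta z

/-- The value of `zetaHatODE` at the generators: `-℘` resp. `-2g₂p² - 3g₃pu`. [folklore] -/
def zetaHatDer (lat : Bool) (z : ℂ) : ℂ :=
  if lat then -(2 * L.g₂) * L.latP z ^ 2 - 3 * L.g₃ * L.latP z * L.latU z else -℘[L] z

/-- **The generators along the line `ξ ↦ w + ξx`** for the chart choice `c`: torus exponentials,
factor generators, and the regularised fibre coordinates `Ñ_e = s'_e - ∑_b κ_{eb} ζ̂_b(z'_b)`.
[folklore] -/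
def genFun (c : γ → Bool) (w x : β ⊕ (γ ⊕ δ) → ℂ) (ξ : ℂ) : Gen β γ δ → ℂ
  | Sum.inl j => cexp (w (iy j) + ξ * x (iy j))
  | Sum.inr (Sum.inl (b, i)) => factorGen L (c b) i (w (iz b) + ξ * x (iz b))
  | Sum.inr (Sum.inr e) => w (is e) + ξ * x (is e) -
      ∑ b, (κM e b : ℂ) * zetaHat L (c b) (w (iz b) + ξ * x (iz b))

/-- The right-hand side of the differential system for the two generators of one `E`-factor
(variables `X (b,0), X (b,1)`), without the direction factor `x_b`:
generic `(X₁, 6X₀² - g₂/2)`, origin chart `(-6X₁² + (g₂/2)X₀², -1/2 - g₂X₁X₀ - (3g₃/2)X₀²)`.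
[folklore] -/
def factorODE (lat : Bool) (b : γ) (i : Fin 2) : MvPolynomial (Gen β γ δ) ℂ :=
  let X0 : MvPolynomial (Gen β γ δ) ℂ := X (Sum.inr (Sum.inl (b, 0)))
  let X1 : MvPolynomial (Gen β γ δ) ℂ := X (Sum.inr (Sum.inl (b, 1)))
  if lat then
    ![-6 * X1 ^ 2 + C (L.g₂ / 2) * X0 ^ 2,
      C (-1 / 2) - C L.g₂ * X1 * X0 - C (3 * L.g₃ / 2) * X0 ^ 2] i
  else
    ![X1, 6 * X0 ^ 2 - C (L.g₂ / 2)] i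

/-- The derivative of `ζ̂` of one factor as a polynomial in its generators (without the factor
`x_b`): `ζ′ = -℘ = -X₀` (generic), `g′ = -2g₂p² - 3g₃pu = -2g₂X₁² - 3g₃X₁X₀` (origin chart).
[folklore] -/
def zetaHatODE (lat : Bool) (b : γ) : MvPolynomial (Gen β γ δ) ℂ :=
  let X0 : MvPolynomial (Gen β γ δ) ℂ := X (Sum.inr (Sum.inl (b, 0)))
  let X1 : MvPolynomial (Gen β γ δ) ℂ := X (Sum.inr (Sum.inl (b, 1)))
  if lat then -(C (2 * L.g₂)) * X1 ^ 2 - C (3 * L.g₃) * X1 * X0 else -X0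

/-- **The differential system of the generators** along the direction `x`:
`E_j′ = x_jE_j`, factor equations times `x_b`, `Ñ_e′ = x_e - ∑_b κ_{eb} x_b ζ̂_b′`. [folklore] -/
def genODE (c : γ → Bool) (x : β ⊕ (γ ⊕ δ) → ℂ) : Gen β γ δ → MvPolynomial (Gen β γ δ) ℂ
  | Sum.inl j => C (x (iy j)) * X (Sum.inl j)
  | Sum.inr (Sum.inl (b, i)) => C (x (iz b)) * factorODE L (c b) b i
  | Sum.inr (Sum.inr e) => C (x (is e)) - ∑ b, C ((κM e b : ℂ) * x (iz b)) * zetaHatODE L (c b) b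

/-! ### The domain of validity of the charts along the line -/

/-- Validity of the chart `lat` of one `E`-factor at the point `z`: generic chart off the lattice,
origin chart where `P₂ ≠ 0`. [folklore] -/
def FactorChartValid (lat : Bool) (z : ℂ) : Prop :=
  if lat then L.univExtP 2 z ≠ 0 else z ∉ L.lattice

/-- The set of parameters `ξ` at which all chosen charts are valid along `ξ ↦ w + ξx`.
[folklore] -/
def chartDomain (c : γ → Bool) (w x : β ⊕ (γ ⊕ δ) → ℂ) : Set ℂ :=
  {ξ | ∀ b, FactorChartValid L (c b) (w (iz b) + ξ * x (iz b))}

omit [Fintype β] [Fintype γ] [Fintype δ] [DecidableEq γ] in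
/-- Validity of one factor chart is an open condition. [folklore] -/
theorem isOpen_factorChartValid (lat : Bool) : IsOpen {z : ℂ | FactorChartValid L lat z} := by
  cases lat
  · simp only [FactorChartValid, Bool.false_eq_true, if_false]
    exact L.isClosed_lattice.isOpen_compl
  · simp only [FactorChartValid, if_true]
    exact isOpen_ne_fun (L.differentiable_univExtP 2).continuous continuous_const

omit [Fintype β] [Fintype δ] [DecidableEq γ] in
/-- **The chart domain is open.** [folklore] -/
theorem isOpen_chartDomain (c : γ → Bool) (w x : β ⊕ (γ ⊕ δ) → ℂ) :
    IsOpen (chartDomain L c w x) := by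
  have : chartDomain L c w x = ⋂ b, (fun ξ : ℂ => w (iz b) + ξ * x (iz b)) ⁻¹'
      {z : ℂ | FactorChartValid L (c b) z} := by
    ext ξ; simp [chartDomain, Set.mem_iInter]
  rw [this]
  exact isOpen_iInter_of_finite fun b =>
    (isOpen_factorChartValid L (c b)).preimage (by fun_prop)

/-- The chart choice adapted to the point `w`: origin chart exactly at the factors with
`w_b ∈ Λ`. [folklore] -/
def chartChoiceAt (w : β ⊕ (γ ⊕ δ) → ℂ) : γ → Bool := fun b =>
  open Classical in if w (iz b) ∈ L.lattice then true else false

omit [Fintype β] [Fintype γ] [Fintype δ] [DecidableEq γ] in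
/-- The adapted chart choice is valid at `ξ = 0`. [folklore] -/
theorem zero_mem_chartDomain_chartChoiceAt (w x : β ⊕ (γ ⊕ δ) → ℂ) :
    (0 : ℂ) ∈ chartDomain L (chartChoiceAt L w) w x := by
  intro b
  simp only [zero_mul, add_zero, chartChoiceAt]
  by_cases hb : w (iz b) ∈ L.lattice
  · simp only [hb, if_true, FactorChartValid]
    obtain ⟨m, n, hmn⟩ := PeriodPair.mem_lattice.mp hb
    rw [← hmn]
    exact (L.latU_latP_latG_lattice m n).1
  · simp [hb, FactorChartValid]

/-! ### The generators solve the system -/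

variable {L}

/-- Simp-normal form of the generators of one factor. [folklore] -/
@[simp] theorem factorGen_false (i : Fin 2) (z : ℂ) :
    factorGen L false i z = ![℘[L] z, ℘'[L] z] i := rfl

/-- Simp-normal form of the generators of one factor (origin chart). [folklore] -/
@[simp] theorem factorGen_true (i : Fin 2) (z : ℂ) :
    factorGen L true i z = ![L.latU z, L.latP z] i := rfl

/-- Simp-normal form of `ζ̂`. [folklore] -/
@[simp] theorem zetaHat_false (z : ℂ) : zetaHat L false z = L.weierstrassZeta z := rfl

/-- Simp-normal form of `ζ̂` (origin chart). [folklore] -/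
@[simp] theorem zetaHat_true (z : ℂ) : zetaHat L true z = L.latG z := rfl

/-- `ζ̂` solves its equation at a valid point. [folklore] -/
theorem hasDerivAt_zetaHat (lat : Bool) {z₀ a ξ : ℂ} (hv : FactorChartValid L lat (z₀ + ξ * a)) :
    HasDerivAt (fun ξ : ℂ => zetaHat L lat (z₀ + ξ * a)) (a * zetaHatDer L lat (z₀ + ξ * a)) ξ := by
  have hlin : HasDerivAt (fun ξ : ℂ => z₀ + ξ * a) a ξ := by
    simpa using ((hasDerivAt_id ξ).mul_const a).const_add z₀
  cases lat
  · have hz : z₀ + ξ * a ∉ L.lattice := by simpa [FactorChartValid] using hv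
    have H : HasDerivAt (fun ξ : ℂ => L.weierstrassZeta (z₀ + ξ * a)) (a * -℘[L] (z₀ + ξ * a)) ξ := by
      have H0 := (PeriodPair.hasDerivAt_weierstrassZeta hz).comp ξ hlin
      exact H0.congr_deriv (by ring)
    simpa [zetaHatDer] using H
  · have h2 : L.univExtP 2 (z₀ + ξ * a) ≠ 0 := by simpa [FactorChartValid] using hv
    have H : HasDerivAt (fun ξ : ℂ => L.latG (z₀ + ξ * a))
        (a * (-(2 * L.g₂) * L.latP (z₀ + ξ * a) ^ 2 - 3 * L.g₃ * L.latP (z₀ + ξ * a) * L.latU (z₀ + ξ * a))) ξ := by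
      have H0 := (PeriodPair.hasDerivAt_latG h2).comp ξ hlin
      exact H0.congr_deriv (by ring)
    simpa [zetaHatDer] using H

omit [Fintype β] [Fintype δ] [DecidableEq γ] in
/-- `zetaHatODE` evaluates to `zetaHatDer` at the generators. [folklore] -/
theorem eval_zetaHatODE (c : γ → Bool) (w x : β ⊕ (γ ⊕ δ) → ℂ) (ξ : ℂ) (b : γ) :
    MvPolynomial.eval (genFun L κM c w x ξ) (zetaHatODE L (c b) b) =
      zetaHatDer L (c b) (w (iz b) + ξ * x (iz b)) := by
  cases hc : c b <;> simp [zetaHatODE, zetaHatDer, genFun, hc]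

omit [Fintype β] [Fintype δ] [DecidableEq γ] in
/-- **The generators solve the polynomial system on the chart domain**: for `ξ` in
`chartDomain c w x` and every generator index `i`,
`(genFun c w x · i)′(ξ) = (genODE c x i)(genFun c w x ξ)`. This is the hypothesis of
`PolyODE.hasDerivAt_eval_of_ode` / `PolyODE.iteratedDeriv_eval_of_ode`.
[cite: BakerWustholz2007, §6.7 (pp. 112–113: the operators 𝒟 act on R)] -/
theorem hasDerivAt_genFun (c : γ → Bool) (w x : β ⊕ (γ ⊕ δ) → ℂ) {ξ : ℂ}
    (hξ : ξ ∈ chartDomain L c w x) (i : Gen β γ δ) :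
    HasDerivAt (fun ξ : ℂ => genFun L κM c w x ξ i)
      (MvPolynomial.eval (genFun L κM c w x ξ) (genODE L κM c x i)) ξ := by
  rcases i with j | ⟨b, i⟩ | e
  · -- torus: `E_j = exp(w_j + ξ x_j)`, `E_j′ = x_j E_j`
    have hlin : HasDerivAt (fun ξ : ℂ => w (iy j) + ξ * x (iy j)) (x (iy j)) ξ := by
      simpa using ((hasDerivAt_id ξ).mul_const (x (iy j))).const_add (w (iy j))
    have H : HasDerivAt (fun ξ : ℂ => cexp (w (iy j) + ξ * x (iy j)))
        (x (iy j) * cexp (w (iy j) + ξ * x (iy j))) ξ := hlin.cexp.congr_deriv (by ring)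
    simpa [genFun, genODE] using H
  · -- an `E`-factor, at `z' = w_b + ξ x_b`
    have hlin : HasDerivAt (fun ξ : ℂ => w (iz b) + ξ * x (iz b)) (x (iz b)) ξ := by
      simpa using ((hasDerivAt_id ξ).mul_const (x (iz b))).const_add (w (iz b))
    have hv : FactorChartValid L (c b) (w (iz b) + ξ * x (iz b)) := hξ b
    cases hc : c b
    · -- generic chart `(℘, ℘′)`
      have hz : w (iz b) + ξ * x (iz b) ∉ L.lattice := by
        simpa [FactorChartValid, hc] using hv
      fin_cases i
      · have H : HasDerivAt (fun ξ : ℂ => ℘[L] (w (iz b) + ξ * x (iz b)))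
            (x (iz b) * ℘'[L] (w (iz b) + ξ * x (iz b))) ξ :=
          by
            have H0 := (PeriodPair.hasDerivAt_weierstrassP hz).comp ξ hlin
            exact H0.congr_deriv (by ring)
        simpa [genFun, genODE, factorODE, hc] using H
      · have H : HasDerivAt (fun ξ : ℂ => ℘'[L] (w (iz b) + ξ * x (iz b)))
            (x (iz b) * (6 * ℘[L] (w (iz b) + ξ * x (iz b)) ^ 2 - L.g₂ / 2)) ξ :=
          by
            have H0 := (L.hasDerivAt_derivWeierstrassP hz).comp ξ hlin
            exact H0.congr_deriv (by ring)
        simpa [genFun, genODE, factorODE, hc] using H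
    · -- origin chart `(u, p)`
      have h2 : L.univExtP 2 (w (iz b) + ξ * x (iz b)) ≠ 0 := by
        simpa [FactorChartValid, hc] using hv
      fin_cases i
      · have H : HasDerivAt (fun ξ : ℂ => L.latU (w (iz b) + ξ * x (iz b)))
            (x (iz b) * (-6 * L.latP (w (iz b) + ξ * x (iz b)) ^ 2 +
              L.g₂ / 2 * L.latU (w (iz b) + ξ * x (iz b)) ^ 2)) ξ :=
          by
            have H0 := (PeriodPair.hasDerivAt_latU h2).comp ξ hlin
            exact H0.congr_deriv (by ring)
        simpa [genFun, genODE, factorODE, hc] using H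
      · have H : HasDerivAt (fun ξ : ℂ => L.latP (w (iz b) + ξ * x (iz b)))
            (x (iz b) * (-1 / 2 - L.g₂ * L.latP (w (iz b) + ξ * x (iz b)) * L.latU (w (iz b) + ξ * x (iz b)) -
              3 * L.g₃ / 2 * L.latU (w (iz b) + ξ * x (iz b)) ^ 2)) ξ :=
          by
            have H0 := (PeriodPair.hasDerivAt_latP h2).comp ξ hlin
            exact H0.congr_deriv (by ring)
        simpa [genFun, genODE, factorODE, hc] using H
  · -- fibre: `Ñ_e = s_e(w) + ξ x_e - ∑_b κ_{eb} ζ̂_b(w_b + ξ x_b)`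
    have hlin : HasDerivAt (fun ξ : ℂ => w (is e) + ξ * x (is e)) (x (is e)) ξ := by
      simpa using ((hasDerivAt_id ξ).mul_const (x (is e))).const_add (w (is e))
    have hsum : HasDerivAt
        (fun ξ : ℂ => ∑ b, (κM e b : ℂ) * zetaHat L (c b) (w (iz b) + ξ * x (iz b)))
        (∑ b, (κM e b : ℂ) * (x (iz b) * zetaHatDer L (c b) (w (iz b) + ξ * x (iz b)))) ξ := by
      exact HasDerivAt.fun_sum (u := Finset.univ)
        (A := fun b (ξ : ℂ) => (κM e b : ℂ) * zetaHat L (c b) (w (iz b) + ξ * x (iz b)))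
        (A' := fun b => (κM e b : ℂ) * (x (iz b) * zetaHatDer L (c b) (w (iz b) + ξ * x (iz b))))
        (x := ξ) fun b _ => (hasDerivAt_zetaHat (c b) (hξ b)).const_mul _
    have H := hlin.sub hsum
    have hval : MvPolynomial.eval (genFun L κM c w x ξ) (genODE L κM c x (Sum.inr (Sum.inr e))) =
        x (is e) - ∑ b, (κM e b : ℂ) * (x (iz b) * zetaHatDer L (c b) (w (iz b) + ξ * x (iz b))) := by
      simp only [genODE, map_sub, map_sum, map_mul, eval_C]
      congr 1
      exact Finset.sum_congr rfl fun b _ => by rw [eval_zetaHatODE]; ring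
    rw [hval]
    exact H

omit [Fintype β] [Fintype δ] [DecidableEq γ] in
/-- **Jets of polynomials in the generators.** On the chart domain the `k`-th derivative at `ξ`
of `ξ ↦ H(genFun ξ)` is the value at `genFun ξ` of `D^k H`, `D` the derivation with
`D Xᵢ = genODE i` (`PolyODEJets.lean`). [folklore] -/
theorem iteratedDeriv_eval_genFun (c : γ → Bool) (w x : β ⊕ (γ ⊕ δ) → ℂ)
    (H : MvPolynomial (Gen β γ δ) ℂ) (k : ℕ) {ξ : ℂ} (hξ : ξ ∈ chartDomain L c w x) :
    iteratedDeriv k (fun ξ : ℂ => MvPolynomial.eval (genFun L κM c w x ξ) H) ξ =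
      MvPolynomial.eval (genFun L κM c w x ξ) ((PolyODE.der (genODE L κM c x))^[k] H) :=
  PolyODE.iteratedDeriv_eval_of_ode (genODE L κM c x) (g := genFun L κM c w x)
    (isOpen_chartDomain L c w x) (fun _ hζ i => hasDerivAt_genFun κM c w x hζ i) k H ξ hξ

end Std

end GaGmE

end Literature.NumberTheory.Transcendental

end
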